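import Summits.ResolutionOfSingularities.ResolutionOfSingularities.Theorems.PurelyInseparableDim4SwapTransportWindowGlue
import Summits.ResolutionOfSingularities.ResolutionOfSingularities.Theorems.PurelyInseparableDim4SwapTransportReadOne
import Summits.ResolutionOfSingularities.ResolutionOfSingularities.Theorems.PurelyInseparableDim4UnitClassVertex
import HarnessLib
import HarnessLib.Audit.Tags

/-!
# Purely inseparable four-folds — WINDOW GLUE FOR EVERY PRIME `p`: which slot a step of a light-pair state of order `p + 1`
# leaves, and the `e_G` transfer through a two-slot slot-unit-class relation (cell `res-dim4-pi`, K2(p) lane, rung-1 POWER-CONE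
# LINE «light pair of TAIL(p, p−1, 3) ∀ p», window half W1a; the `p = 5` instances are `…SwapTransportWindowGlue` p699161 and
# `…SwapTransportWindowStepFull.eG_transfer` p700979)

[OURS · counted 0 · cell `res-dim4-pi` · K2(p) lane (holder res-dim4-p-12 g5, ruling g5-2 (6): the C∞-PRIME port, one
p-generic file at a time) · seat res-dim4-typ-1 g5.]  Nothing here proves K2(p) for any `p`, any TAIL(p, p−1, 3), any
TAIL(7, d, e), `NoIsolatedTrap p p` or resolution of singularities in dimension ≥ 4 / characteristic `p` — NOT proved.  AI kernel
work, weaker than expert review.  Bookkeeping only; kills nothing.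

DICTIONARY against `p = 5`: `Step 5 ↦ Step p`, `ord₀ = 6 ↦ ord₀ = p + 1` (ledger `x_x x_y` of weight `2`, shade `p − 1`; newborn
slot weight `(p + 1) − p = 1` by res-dim4-p-8 g5's `step_r_apply_gen`).
* §1 `step_r_apply_succ`, **`step_cases_of_weights_prime`** (slot `x` / slot `y` / rotation through a free letter, from the
  child's weights `≤ 1` of total `2`), `step_r_pair_of_slot` (the ledger `x_x x_y` survives a slot step keeping `y`).
* §2 `not_dvd_succ_of_prime`, **`eG_transfer_prime`** — `e_G` agrees on both sides of a two-slot slot-unit-class relation at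
  order `p + 1` (res-dim4-p-7 g4's p-generic `SwapNorm.finrank_resVertex_eq_of_slotUnit_rel₂`, tangent `IsUnit` by
  `isUnit_det_slotUnitClass₂`); at `5` this was the BY-VALUE hypothesis `hEG` of `virtual_core_*`.
[cite: Hauser2010, §§F–G] [cite: CossartJannsenSaito2020, Thm. 3.14]
bears_on: LADDER-RESOLUTION:D157-DOOR2 (res-dim4-pi · K2(p) · power cones · re-presentation).  Supports
stmt-ResolutionOfSingularities-16155 (helper).
-/

set_option linter.dupNamespace false -- mandated namespace of this single-conjunct summit

noncomputable section

namespace Summit.ResolutionOfSingularities.ResolutionOfSingularities.Theorems.PIDim4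

namespace SwapTransport

open MvPolynomial Finset
open Literature.AlgebraicGeometry.Resolution
open Literature.AlgebraicGeometry.Resolution.CentreBlowup
open Literature.AlgebraicGeometry.Resolution.Hauser2010
open Literature.AlgebraicGeometry.Resolution.HauserPerlega2019

variable {K : Type} [Field K] [DecidableEq K]

/-! ## §1 Which slot a step leaves, every prime -/

/-- The weights of the child of a state of order `p + 1` under `Step p`, letter by letter: the chart letter gets `1`, a translated
letter `0`, the others keep their weight. [folklore] [cite: Hauser2010, §F (transform D')] -/
theorem step_r_apply_succ (p : ℕ) {A : State K} (ho : ordZero A.F = ((p + 1 : ℕ) : ℕ∞)) (jr : Fin 4) (b : Fin 4 → K)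
    (i : Fin 4) :
    (CentreBlowup.step p Finset.univ jr b A).r i = if i = jr then 1 else if b i = 0 then A.r i else 0 := by
  rw [step_r_apply_gen p ho jr b i, Nat.add_sub_cancel_left]

/-- **WHICH SLOT A STEP LEAVES, every prime.**  `A` has ledger `x_x x_y` (two weight-1 letters among the four distinct letters
`x, y, v, w`), order `p + 1`; a `Step p` in chart `jr` with translation `b` whose child has weights `≤ 1` of total weight `2` is:
(slot `x`) `jr = x`, `b y = 0`, child ledger `x_x x_y`; or (slot `y`) symmetrically; or (rotation through `jr ∈ {v, w}`) exactly one
of `x, y` is kept and the child ledger is `x_{jr}·x_{kept}`. [OURS] [cite: Hauser2010, §F] -/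
theorem step_cases_of_weights_prime (p : ℕ) {x y v w : Fin 4} (hxy : x ≠ y) (hxv : x ≠ v) (hxw : x ≠ w) (hyv : y ≠ v)
    (hyw : y ≠ w) (hvw : v ≠ w) {A : State K} (hrA : A.r = Finsupp.single x 1 + Finsupp.single y 1)
    (ho : ordZero A.F = ((p + 1 : ℕ) : ℕ∞)) {jr : Fin 4} {b : Fin 4 → K}
    (hw1 : ∀ i, (CentreBlowup.step p Finset.univ jr b A).r i ≤ 1)
    (hdeg : (CentreBlowup.step p Finset.univ jr b A).r.degree = 2) :
    (jr = x ∧ b y = 0 ∧ (CentreBlowup.step p Finset.univ jr b A).r = Finsupp.single x 1 + Finsupp.single y 1) ∨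
    (jr = y ∧ b x = 0 ∧ (CentreBlowup.step p Finset.univ jr b A).r = Finsupp.single x 1 + Finsupp.single y 1) ∨
    ((jr = v ∨ jr = w) ∧
      ((b x ≠ 0 ∧ b y = 0 ∧ (CentreBlowup.step p Finset.univ jr b A).r = Finsupp.single jr 1 + Finsupp.single y 1) ∨
       (b y ≠ 0 ∧ b x = 0 ∧ (CentreBlowup.step p Finset.univ jr b A).r = Finsupp.single jr 1 + Finsupp.single x 1))) := by
  have _ := hw1
  set r' := (CentreBlowup.step p Finset.univ jr b A).r with hr'
  have hval : ∀ i, r' i = if i = jr then 1 else if b i = 0 then A.r i else 0 := fun i => by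
    rw [hr']; exact step_r_apply_succ p ho jr b i
  obtain ⟨hAx, hAy, hAv, hAw⟩ := ResCone.quad_apply hxy hxv hxw hyv hyw hvw 1 1 0 0
  have hrA' : A.r = Finsupp.single x 1 + Finsupp.single y 1 + Finsupp.single v 0 + Finsupp.single w 0 := by
    rw [hrA, Finsupp.single_zero, Finsupp.single_zero, add_zero, add_zero]
  rw [← hrA'] at hAx hAy hAv hAw
  have hsum : r'.degree = r' x + r' y + r' v + r' w := ResCone.degree_eq_quad hxy hxv hxw hyv hyw hvw r'
  rw [hdeg] at hsum
  have hr'eq : r' = Finsupp.single x (r' x) + Finsupp.single y (r' y) + Finsupp.single v (r' v) + Finsupp.single w (r' w) :=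
    ResCone.eq_sum_single_four hxy hxv hxw hyv hyw hvw r'
  have hrx := hval x
  have hry := hval y
  have hrv := hval v
  have hrw := hval w
  rw [hAx] at hrx
  rw [hAy] at hry
  rw [hAv, ite_self] at hrv
  rw [hAw, ite_self] at hrw
  rcases ResCone.letters_exhaust hxy hxv hxw hyv hyw hvw jr with h | h | h | h
  · -- slot `x`
    subst h
    refine Or.inl ⟨rfl, ?_, ?_⟩
    · by_contra hby
      rw [if_pos rfl] at hrx
      rw [if_neg (Ne.symm hxy), if_neg hby] at hry
      rw [if_neg (Ne.symm hxv)] at hrv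
      rw [if_neg (Ne.symm hxw)] at hrw
      omega
    · have hby : b y = 0 := by
        by_contra hby
        rw [if_pos rfl] at hrx
        rw [if_neg (Ne.symm hxy), if_neg hby] at hry
        rw [if_neg (Ne.symm hxv)] at hrv
        rw [if_neg (Ne.symm hxw)] at hrw
        omega
      rw [if_pos rfl] at hrx
      rw [if_neg (Ne.symm hxy), if_pos hby] at hry
      rw [if_neg (Ne.symm hxv)] at hrv
      rw [if_neg (Ne.symm hxw)] at hrw
      rw [hr'eq, hrx, hry, hrv, hrw, Finsupp.single_zero, Finsupp.single_zero, add_zero, add_zero]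
  · -- slot `y`
    subst h
    refine Or.inr (Or.inl ⟨rfl, ?_, ?_⟩)
    · by_contra hbx
      rw [if_neg hxy, if_neg hbx] at hrx
      rw [if_pos rfl] at hry
      rw [if_neg (Ne.symm hyv)] at hrv
      rw [if_neg (Ne.symm hyw)] at hrw
      omega
    · have hbx : b x = 0 := by
        by_contra hbx
        rw [if_neg hxy, if_neg hbx] at hrx
        rw [if_pos rfl] at hry
        rw [if_neg (Ne.symm hyv)] at hrv
        rw [if_neg (Ne.symm hyw)] at hrw
        omega
      rw [if_neg hxy, if_pos hbx] at hrx
      rw [if_pos rfl] at hry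
      rw [if_neg (Ne.symm hyv)] at hrv
      rw [if_neg (Ne.symm hyw)] at hrw
      rw [hr'eq, hrx, hry, hrv, hrw, Finsupp.single_zero, Finsupp.single_zero, add_zero, add_zero]
  · -- rotation through `v`
    subst h
    refine Or.inr (Or.inr ⟨Or.inl rfl, ?_⟩)
    rw [if_neg hxv] at hrx
    rw [if_neg hyv] at hry
    rw [if_pos rfl] at hrv
    rw [if_neg (Ne.symm hvw)] at hrw
    by_cases hbx : b x = 0
    · rw [if_pos hbx] at hrx
      have hby : b y ≠ 0 := by
        intro hby; rw [if_pos hby] at hry; omega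
      rw [if_neg hby] at hry
      refine Or.inr ⟨hby, hbx, ?_⟩
      rw [hr'eq, hrx, hry, hrv, hrw, Finsupp.single_zero, Finsupp.single_zero, add_zero, add_zero, add_comm]
    · rw [if_neg hbx] at hrx
      have hby : b y = 0 := by
        by_contra hby; rw [if_neg hby] at hry; omega
      rw [if_pos hby] at hry
      refine Or.inl ⟨hbx, hby, ?_⟩
      rw [hr'eq, hrx, hry, hrv, hrw, Finsupp.single_zero, Finsupp.single_zero, zero_add, add_zero, add_comm]
  · -- rotation through `w`
    subst h
    refine Or.inr (Or.inr ⟨Or.inr rfl, ?_⟩)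
    rw [if_neg hxw] at hrx
    rw [if_neg hyw] at hry
    rw [if_neg hvw] at hrv
    rw [if_pos rfl] at hrw
    by_cases hbx : b x = 0
    · rw [if_pos hbx] at hrx
      have hby : b y ≠ 0 := by
        intro hby; rw [if_pos hby] at hry; omega
      rw [if_neg hby] at hry
      refine Or.inr ⟨hby, hbx, ?_⟩
      rw [hr'eq, hrx, hry, hrv, hrw, Finsupp.single_zero, Finsupp.single_zero, add_zero, add_zero, add_comm]
    · rw [if_neg hbx] at hrx
      have hby : b y = 0 := by
        by_contra hby; rw [if_neg hby] at hry; omega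
      rw [if_pos hby] at hry
      refine Or.inl ⟨hbx, hby, ?_⟩
      rw [hr'eq, hrx, hry, hrv, hrw, Finsupp.single_zero, Finsupp.single_zero, zero_add, add_zero, add_comm]

/-- The ledger `x_x x_y` survives a slot step in the chart of `x` with a translation vanishing on `y` (order `p + 1`). [OURS ·
bookkeeping] -/
theorem step_r_pair_of_slot (p : ℕ) {x y v w : Fin 4} (hxy : x ≠ y) (hxv : x ≠ v) (hxw : x ≠ w) (hyv : y ≠ v) (hyw : y ≠ w)
    (hvw : v ≠ w) {B : State K} (hrB : B.r = Finsupp.single x 1 + Finsupp.single y 1)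
    (hoB : ordZero B.F = ((p + 1 : ℕ) : ℕ∞)) {b' : Fin 4 → K} (hb'y : b' y = 0) :
    (CentreBlowup.step p Finset.univ x b' B).r = Finsupp.single x 1 + Finsupp.single y 1 := by
  obtain ⟨-, h2, h3, h4⟩ := ResCone.quad_apply hxy hxv hxw hyv hyw hvw 1 1 0 0
  have hrB4 : B.r = Finsupp.single x 1 + Finsupp.single y 1 + Finsupp.single v 0 + Finsupp.single w 0 := by
    rw [hrB, Finsupp.single_zero, Finsupp.single_zero, add_zero, add_zero]
  rw [ResCone.eq_sum_single_four hxy hxv hxw hyv hyw hvw (CentreBlowup.step p Finset.univ x b' B).r, step_r_apply_succ p hoB,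
    step_r_apply_succ p hoB, step_r_apply_succ p hoB, step_r_apply_succ p hoB, if_pos rfl, if_neg hxy.symm, if_pos hb'y,
    if_neg (Ne.symm hxv), if_neg (Ne.symm hxw), hrB4, h2, h3, h4, ite_self, ite_self, Finsupp.single_zero, Finsupp.single_zero,
    add_zero, add_zero]

/-! ## §2 `e_G` through the relation, every prime -/

/-- **`p ∤ p + 1`** for a prime `p`. [folklore] -/
theorem not_dvd_succ_of_prime {p : ℕ} (hp : p.Prime) : ¬ p ∣ p + 1 := fun h =>
  hp.one_lt.ne' (Nat.dvd_one.mp ((Nat.dvd_add_right (dvd_refl p)).mp h))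

omit [DecidableEq K] in
/-- **`e_G` TRANSFER, every prime** — through a two-slot slot-unit-class relation at order `p + 1` the polar-kernel ranks agree
(res-dim4-p-7 g4's `SwapNorm.finrank_resVertex_eq_of_slotUnit_rel₂`, tangent `IsUnit` from the free `2 × 2` block by
`isUnit_det_slotUnitClass₂`).  At `5` this was the hypothesis `hEG` of `virtual_core_*`, taken BY VALUE. [OURS · composition] -/
theorem eG_transfer_prime (p : ℕ) [Fact p.Prime] [CharP K p] {π : Equiv.Perm (Fin 4)} {la mu u f : Fin 4} (hlm : la ≠ mu)
    (hlu : la ≠ u) (hlf : la ≠ f) (hmu : mu ≠ u) (hmf : mu ≠ f) (huf : u ≠ f) {A B : State K}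
    {θ e : Fin 4 → MvPolynomial (Fin 4) K} {U E : MvPolynomial (Fin 4) K} {M : ℕ}
    (hθa : θ (π la) = X la * e la) (hθa' : θ (π mu) = X mu * e mu) (hea : constantCoeff (e la) ≠ 0)
    (hea' : constantCoeff (e mu) ≠ 0) (hu0 : constantCoeff (θ (π u)) = 0) (hf0 : constantCoeff (θ (π f)) = 0)
    (hdet : coeff (Finsupp.single u 1) (θ (π u)) * coeff (Finsupp.single f 1) (θ (π f)) -
      coeff (Finsupp.single f 1) (θ (π u)) * coeff (Finsupp.single u 1) (θ (π f)) ≠ 0)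
    (hU : constantCoeff U ≠ 0) (hE : E ∈ originIdeal K ^ M) (hrel : B.F = deletePthPowers p (U ^ p * aeval θ A.F) + E)
    (hrA : A.r = Finsupp.single (π la) 1 + Finsupp.single (π mu) 1) (hrB : B.r = Finsupp.single la 1 + Finsupp.single mu 1)
    (hdivA : ∀ d ∈ A.F.support, A.r ≤ d) (hoA : ordZero A.F = ((p + 1 : ℕ) : ℕ∞)) (hoM : p + 1 < M) :
    Module.finrank K (ResCone.resVertex B) = Module.finrank K (ResCone.resVertex A) :=
  SwapNorm.finrank_resVertex_eq_of_slotUnit_rel₂ p hlm hlu hlf hmu hmf huf hθa hθa' hea hea' hu0 hf0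
    (isUnit_det_slotUnitClass₂ hlm hlu hlf hmu hmf huf hθa hθa' hea hea' hdet) hU hE hrel hrA hrB hdivA hoA
    (not_dvd_succ_of_prime (Fact.out)) hoM

end SwapTransport

end Summit.ResolutionOfSingularities.ResolutionOfSingularities.Theorems.PIDim4

end
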